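import Literature.MathematicalPhysics.QuantumFieldTheory.Balaban1983to89.B2Eq236Replacements

/-!
# `Balaban1983to89.B2Eq238ScalarBoundary` — [Balaban1982Higgs2] (2.38)–(2.39) p. 565: the scalar-field boundary terms of
the second representation (2.34) with the conditioned covariance `C^{(0)}_{Λ₅}(B^{(1)})` replaced by the one with boundary
conditions decoupling `Λ₆`, `C^{(0)}_{Λ₅}(Λ₆ᶜ, B^{(1)})` — the exact parts PROVED (linearity in the kernel) and the
`O(ε^κ)|∂Λ₅|` errors PROVED from the Proposition I.2.1 shape ((I.2.25)–(I.2.26)) + the separation of (2.8), *"for arbitrary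
κ"* via `…B2StepK.rDecayBeatsPowers` (`decay_thresholds_pow₂`)

statement-level skeleton of published theorems with citation tags; proofs where landed; nothing here is a claim about the Yang–Mills mass gap

PDF held: `paper:balaban1982-cmp86-higgs23-ii` (T. Bałaban, *(Higgs)₂,₃ quantum fields in a finite volume. II. An upper
bound*, Commun. Math. Phys. **86** (1982) 555–594, doi 10.1007/bf01214890; journal page = PDF page + 554); p. 565 [PDF 11]
READ AS AN IMAGE (`run/shared/lean/pub/pub-balaban/b2b-balaban-ref1/pages/1982-cmp86-higgs23-II/…-p011-x2.png`); part I
[Balaban1982Higgs1] Prop. 2.1 p. 610 [PDF 8] and Prop. 2.3 p. 611 [PDF 9] read as images likewise.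

CITATION HEADER — WHAT IS REPRODUCED.  SKELETON row **B2.Eq2.42** ((2.20)–(2.42)), members **(2.38)** and **(2.39)**
p. 565 (the scalar twins of (2.36); the twin (2.40) of (2.37) is the sequel `…B2Eq240ScalarForm`).  Unit `lit-balaban-p15`
gen 3 (Phase-2 proof seat p15; HOME `run/shared/lean/pub/lit-balaban/`, seat dir `lit-balaban-p15/`); B2 fold owner r02,
second reader r14; referee ref-4.  Inputs by name: r02's boundary sum `B2Eq224FirstStepFields.bdry226` (p248319); part
(2.36)'s `B2Eq236Replacements.bdryWeight` / `bdrySize` / `bdry226_eq_sum_weight` / `sum_abs_bdryWeight_le` / `pFn_le_rpow`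
and p23 g4's `B2Lemma25Proof.damped_sum_bound` (p247392); r14's `B2StepK.rDecayBeatsPowers` (p240722).

WHAT IS PRINTED (p. 565 [PDF 11], verbatim).  *"Similar representations and estimates hold for the scalar field
expressions, but there are essential changes also. In this case it is convenient to make all the expressions, except the
basic quadratic form, independent of the field B^{(1)}↾_{Λ₇}, because then they are unchanged in the next step of the
procedure. This is achieved by imposing proper boundary conditions on the fundamental Laplace difference operator. We have
from Proposition I.2.1.
 ½ Σ_{b,b′∈st(Λ₅)} φ(b₊)·U(B^{(1)}_{−b}) C^{(0)}_{Λ₅}(B^{(1)}; b₋, b′₋) U(B^{(1)}_{b′}) φ(b′₊)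
   = ½ Σ_{b,b′∈st(Λ₅)} φ(b₊)·U(B^{(1)}_{−b}) C^{(0)}_{Λ₅}(Λ₆ᶜ, B^{(1)}; b₋, b′₋) U(B^{(1)}_{b′}) φ(b′₊) + O(ε^κ)|∂Λ₅|,   (2.38)
 aL⁻² Σ_{b∈st(Λ₅)} φ(b₊)·U(B^{(1)}_{−b}) (C^{(0)}_{Λ₅}(B^{(1)}) Q*(B^{(1)})ψ)(b₋)
   = aL⁻² Σ_{b∈st(Λ₅)} φ(b₊)·U(B^{(1)}_{−b}) (C^{(0)}_{Λ₅}(Λ₆ᶜ, B^{(1)}) Q*(B^{(1)})ψ)(b₋) + O(ε^κ)|∂Λ₅|,   (2.39)"*.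
The input, part I Prop. 2.1 p. 610, verbatim: *"|(D^η_{A,μ}G_k(Ω, A)f)(x)|, |(G_k(Ω, A)f)(x)| ≦ c₀ exp(−δ₀ dist(x, supp f))‖f‖_∞
(2.25) for x ∈ Ω, dist(x, Ωᶜ) ≧ R₀. If Ω ⊂ Ω₀, then for δG_k(Ω, Ω₀, A) defined by the equality δG_k(Ω, Ω₀, A) = G_k(Ω, A) −
G_k(Ω₀, A), (2.26) we have the inequalities (2.24), (2.25) with the additional factor exp(−δ₀ dist(supp f, Ωᶜ) −
δ₀ dist({x, x′}, Ωᶜ)) on the right sides."*  At `Ω = Λ₆ᶜ` and `f = δ_{x″}` this is the ROW-DAMPED kernel shape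
`|δC(x′, x″)| ≤ c₀e^{−δ₀(|x′ − x″| + dist(x′, Λ₆))}` for `dist(x′, Λ₆) ≥ R₀` (the factor `e^{−δ₀dist(x″, Λ₆)} ≤ 1` dropped);
the inner endpoints `b₋` of `st(Λ₅)` are farther than `r(ε)` from `Λ₆` by (2.8) p. 558 (*"Λ_{i+1}ᶜ is the sum of all
large blocks of T₁ with distances from the set Λ_iᶜ less or equal r(ε)"*).  The smallness of `φ` on `∂Λ₅` and of `ψ` on
`Λ′₅` is (2.2)/(2.17): `|φ| ≦ p(ε)(λε^{4−d})^{−1/4}`, `|ψ − Q(A)φ| ≦ p(ε)`.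

THE ARGUMENT (the print gives none beyond the pointer to Prop. I.2.1).  Both terms are LINEAR in the kernel, so each left
side equals the right side plus the same expression with the kernel `δC := C^{(0)}_{Λ₅}(B^{(1)}) − C^{(0)}_{Λ₅}(Λ₆ᶜ, B^{(1)})`;
in components (r02's convention `U = −D`) the boundary weights `a(x′) = Σ_{x∉Λ₅} φ(x)(−D x x′)` live on the inner boundary
`∂⁻Λ₅`, at distance `≥ R ≈ r(ε)` from `Λ₆`, so the row-damped shape gives `|Σ_{x′,x″} a(x′)δC(x′,x″)g(x″)| ≤
(Σ|a|)·c₀e^{−δ₀R}·sup|g|·Ssum` with `g = a` ((2.38)) or `g = Q*ψ` ((2.39)): `O(e^{−δ₀r(ε)})·(thresholds)²·|∂Λ₅| = O(ε^κ)|∂Λ₅|`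
for every κ, the decay beating any power of the logarithmic thresholds ((2.109), `rDecayBeatsPowers`).

DICTIONARY = that of `…B2Eq236Replacements` (r02's plain real coordinates): `X`/`Y` fine/block components, `D` ↤
`Δ^{(0)}(B^{(1)})` (covariant, `U(B^{(1)}_b)` entries `= −D`), `Q`, `Qs = w•Qᵀ` ↤ `Q(B^{(1)})`, `Q*(B^{(1)})`, `c` ↤ `aL⁻²`,
`Λ` ↤ `Λ₅`, `Λ'` ↤ `Λ′₅` (`hQ` block structure), `CΛ` ↤ `C^{(0)}_{Λ₅}(B^{(1)})`, `C6` ↤ `C^{(0)}_{Λ₅}(Λ₆ᶜ, B^{(1)})` (both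
zero-extended off `Λ₅ × Λ₅`: `hCs`, `hCs6`), `v` ↤ `dist(·, Λ₆)`, `d` ↤ `|x′ − x″|`; the ROW-DAMPED SHAPE `hδ6` on the rows
`x′ ∈ Λ₅` with `v(x′) ≥ R` ((I.2.25)–(I.2.26)); `hfar` ↤ (2.8) (inner endpoints of `st(Λ₅)` have `v ≥ R`); `Gφ` ↤ the
threshold for `|φ|` at the outer endpoints of `st(Λ₅)`, `Gψ` for `|ψ|` on `Λ′₅`; `nD` ↤ `sup_{x′}Σ_{x∉Λ₅}|D x x′|` (`≤ 2d`);
`bdrySize Λ D` ↤ `|∂Λ₅|` up to `2d`; `Ssum` ↤ `sup_{x′}Σ_{x″}e^{−½δ₀|x′−x″|}`.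

WHAT IS KERNEL-CHECKED (zero `sorry`, standard axioms, no `Prop`-valued definition; one plain `def` `dbl238`).
 §0 `decay_thresholds_pow₂` (*"arbitrary κ"* for a product of two thresholds `Kᵢ·p(ℓ)·ℓ^{−mᵢ}`); §1 `bilin_rowdamped_bound`
    (the row-damped bilinear engine, from p23's `damped_sum_bound`);
 §2 **(2.38)**: `dbl238` (the double boundary sum `½Σ_{b,b′}φ(b₊)U C(b₋,b′₋)U φ(b′₊)` in components), `dbl238_sub` (linearity
    in the kernel), **`eq238_exact`**, `abs_bdryWeight_le`, `bdryWeight_ne_zero`, **`eq238_error_bound`** (`|dbl238(δC)| ≤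
    ½·Gφ·bdrySize·c₀e^{−δ₀R}·Gφ·nD·Ssum`), **`eq238_error_pow`** (`≤ ½c₀nD·Ssum·C_κℓ^κ·bdrySize`);
 §3 **(2.39)**: `bdry226_kernel_sub`, **`eq239_exact`**, `abs_Qs_mulVec_le_of_mem`, **`eq239_error_bound`** (`|bdry226(δC)| ≤
    |c|·Gφ·bdrySize·c₀e^{−δ₀R}·qs₁Gψ·Ssum`), **`eq239_error_pow`**.
HONEST SCOPE.  The kernels are data; the row-damped shape (from Prop. I.2.1 as the print says), the Dirichlet supports, the
block structure and the separation of (2.8) are HYPOTHESES in the printed form; `bdrySize ≍ |∂Λ₅|` up to `2d`; nothing about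
the functional integral (2.33) is asserted.
-/

namespace Literature.MathematicalPhysics.QuantumFieldTheory.Balaban1983to89.B2Eq238ScalarBoundary

open Real Matrix
open B2Eq224FirstStepFields (bdry226)
open B2Lemma25Proof (damped_sum_bound)
open B2Eq236Replacements (pFn_le_rpow pFn_nonneg abs_bilin_le bdryWeight bdrySize bdry226_eq_sum_weight
  sum_abs_bdryWeight_le)

/-! ## §0 *"for arbitrary κ"* with two thresholds of the printed logarithmic-times-power form -/

/-- **"for arbitrary κ"** (p. 565) for a product of two thresholds `Tᵢ = Kᵢ·p(ℓ)·ℓ^{−mᵢ}` ((2.2): `p(ε)/(μ₀ε)`,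
`p(ε)(λε^{4−d})^{−1/4}`, `p(ε)`): for `a > 0`, the ranges `R > 0`, `r > 1` of (2.7), `b₀ ≥ 0`, `p ≥ 0`, `Kᵢ ≥ 0` and every real
`κ` there is `C ≥ 0` with `e^{−a·r(ℓ)}·T₁(ℓ)T₂(ℓ) ≤ C·ℓ^κ` on `(0,1]` (`rDecayBeatsPowers` at the exponent `κ + 2p + m₁ + m₂`).
[cite: Balaban1982Higgs2, (2.38)–(2.39) p.565] -/
theorem decay_thresholds_pow₂ {a Rr r b₀ p K₁ m₁ K₂ m₂ : ℝ} (ha : 0 < a) (hR : 0 < Rr) (hr : 1 < r) (hb : 0 ≤ b₀)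
    (hp : 0 ≤ p) (hK₁ : 0 ≤ K₁) (hK₂ : 0 ≤ K₂) (κ : ℝ) :
    ∃ C : ℝ, 0 ≤ C ∧ ∀ ℓ : ℝ, 0 < ℓ → ℓ ≤ 1 →
      Real.exp (-(a * B2.rFn Rr r ℓ)) * ((K₁ * B2.pFn b₀ p ℓ * ℓ ^ (-m₁)) * (K₂ * B2.pFn b₀ p ℓ * ℓ ^ (-m₂)))
        ≤ C * ℓ ^ κ := by
  obtain ⟨C₀, hC₀⟩ := B2StepK.rDecayBeatsPowers ha hR hr (κ + 2 * p + m₁ + m₂)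
  refine ⟨max C₀ 0 * (K₁ * K₂ * b₀ ^ 2), by positivity, fun ℓ hℓ hℓ1 => ?_⟩
  have hexp : Real.exp (-(a * B2.rFn Rr r ℓ)) ≤ max C₀ 0 * ℓ ^ (κ + 2 * p + m₁ + m₂) :=
    (hC₀ ℓ hℓ hℓ1).trans (mul_le_mul_of_nonneg_right (le_max_left _ _) (Real.rpow_nonneg hℓ.le _))
  have hpℓ : B2.pFn b₀ p ℓ ≤ b₀ * ℓ ^ (-p) := pFn_le_rpow hb hp hℓ hℓ1
  have hp0 : 0 ≤ B2.pFn b₀ p ℓ := pFn_nonneg hb hℓ hℓ1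
  have hT₁ : K₁ * B2.pFn b₀ p ℓ * ℓ ^ (-m₁) ≤ K₁ * (b₀ * ℓ ^ (-p)) * ℓ ^ (-m₁) :=
    mul_le_mul_of_nonneg_right (mul_le_mul_of_nonneg_left hpℓ hK₁) (Real.rpow_nonneg hℓ.le _)
  have hT₂ : K₂ * B2.pFn b₀ p ℓ * ℓ ^ (-m₂) ≤ K₂ * (b₀ * ℓ ^ (-p)) * ℓ ^ (-m₂) :=
    mul_le_mul_of_nonneg_right (mul_le_mul_of_nonneg_left hpℓ hK₂) (Real.rpow_nonneg hℓ.le _)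
  have hT₁0 : 0 ≤ K₁ * B2.pFn b₀ p ℓ * ℓ ^ (-m₁) := mul_nonneg (mul_nonneg hK₁ hp0) (Real.rpow_nonneg hℓ.le _)
  have hT₂0 : 0 ≤ K₂ * B2.pFn b₀ p ℓ * ℓ ^ (-m₂) := mul_nonneg (mul_nonneg hK₂ hp0) (Real.rpow_nonneg hℓ.le _)
  calc Real.exp (-(a * B2.rFn Rr r ℓ)) * ((K₁ * B2.pFn b₀ p ℓ * ℓ ^ (-m₁)) * (K₂ * B2.pFn b₀ p ℓ * ℓ ^ (-m₂)))
      ≤ (max C₀ 0 * ℓ ^ (κ + 2 * p + m₁ + m₂))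
          * ((K₁ * (b₀ * ℓ ^ (-p)) * ℓ ^ (-m₁)) * (K₂ * (b₀ * ℓ ^ (-p)) * ℓ ^ (-m₂))) :=
        mul_le_mul hexp (mul_le_mul hT₁ hT₂ hT₂0 (hT₁0.trans hT₁)) (mul_nonneg hT₁0 hT₂0) (by positivity)
    _ = max C₀ 0 * (K₁ * K₂ * b₀ ^ 2)
          * (ℓ ^ (κ + 2 * p + m₁ + m₂) * ℓ ^ (-p) * ℓ ^ (-m₁) * ℓ ^ (-p) * ℓ ^ (-m₂)) := by ring
    _ = max C₀ 0 * (K₁ * K₂ * b₀ ^ 2) * ℓ ^ κ := by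
        rw [← Real.rpow_add hℓ, ← Real.rpow_add hℓ, ← Real.rpow_add hℓ, ← Real.rpow_add hℓ]
        ring_nf

/-! ## §1 The row-damped bilinear engine ((I.2.25)–(I.2.26)) -/

section Engine

variable {X : Type*}

/-- **ROW-DAMPED bilinear engine**: if `|δC(x,x′)| ≤ c₀e^{−δ(d(x,x′) + u(x))}` on `S₁ × S₂` with `u ≥ R` on the support of
`f`, `d ≥ 0`, `|g| ≤ G` on `S₂`, `Σ_{S₁}|f| ≤ F`, `Σ_{x′∈S₂}e^{−½δd(x,x′)} ≤ Ssum` (`Ssum ≥ 0`), then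
`|Σ_{x∈S₁}Σ_{x′∈S₂} f(x)δC(x,x′)g(x′)| ≤ F·c₀e^{−δR}·G·Ssum` (p23's `damped_sum_bound` row by row, no column damping).
[cite: Balaban1982Higgs2, (2.38) p.565] -/
theorem bilin_rowdamped_bound {S₁ S₂ : Finset X} {f g : X → ℝ} {Dk d : X → X → ℝ} {u : X → ℝ}
    {c₀ δ R G F Ssum : ℝ} (hc₀ : 0 ≤ c₀) (hδ : 0 ≤ δ) (hG : 0 ≤ G) (hF : ∑ x ∈ S₁, |f x| ≤ F)
    (hD : ∀ x ∈ S₁, ∀ x' ∈ S₂, |Dk x x'| ≤ c₀ * Real.exp (-(δ * (d x x' + u x))))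
    (hu : ∀ x ∈ S₁, f x ≠ 0 → R ≤ u x) (hd : ∀ x ∈ S₁, ∀ x' ∈ S₂, 0 ≤ d x x')
    (hg : ∀ x' ∈ S₂, |g x'| ≤ G) (hS0 : 0 ≤ Ssum)
    (hS : ∀ x ∈ S₁, ∑ x' ∈ S₂, Real.exp (-(δ / 2 * d x x')) ≤ Ssum) :
    |∑ x ∈ S₁, ∑ x' ∈ S₂, f x * Dk x x' * g x'| ≤ F * (c₀ * Real.exp (-(δ * R)) * G * Ssum) := by
  have hterm : ∀ x ∈ S₁, |f x| * |∑ x' ∈ S₂, Dk x x' * g x'|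
      ≤ |f x| * (c₀ * Real.exp (-(δ * R)) * G * Ssum) := by
    intro x hx
    by_cases hfx : f x = 0
    · rw [hfx, abs_zero, zero_mul, zero_mul]
    · refine mul_le_mul_of_nonneg_left ?_ (abs_nonneg _)
      have hD' : ∀ x' ∈ S₂, |Dk x x'| ≤ c₀ * Real.exp (-(δ * (d x x' + u x + (fun _ => (0 : ℝ)) x'))) :=
        fun x' hx' => by simpa only [add_zero] using hD x hx x' hx'
      exact damped_sum_bound (u' := fun _ => (0 : ℝ)) hc₀ hδ hG (hu x hx hfx) (fun _ _ => le_rfl) (hd x hx) hD' hg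
        (hS x hx)
  calc |∑ x ∈ S₁, ∑ x' ∈ S₂, f x * Dk x x' * g x'|
      ≤ ∑ x ∈ S₁, |f x| * |∑ x' ∈ S₂, Dk x x' * g x'| := abs_bilin_le S₁ S₂ f g Dk
    _ ≤ ∑ x ∈ S₁, |f x| * (c₀ * Real.exp (-(δ * R)) * G * Ssum) := Finset.sum_le_sum hterm
    _ = (∑ x ∈ S₁, |f x|) * (c₀ * Real.exp (-(δ * R)) * G * Ssum) := by rw [Finset.sum_mul]
    _ ≤ F * (c₀ * Real.exp (-(δ * R)) * G * Ssum) := mul_le_mul_of_nonneg_right hF (by positivity)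

end Engine

/-! ## §2 **(2.38)**: the double boundary term -/

section Scalar

variable {X Y : Type*} [Fintype X] [Fintype Y] [DecidableEq X] [DecidableEq Y]

omit [Fintype Y] [DecidableEq Y] in
/-- The double boundary sum of (2.34)/(2.38) in components: `½Σ_{b,b′∈st(Λ₅)} φ(b₊)·U(B_{−b}) C(b₋, b′₋) U(B_{b′}) φ(b′₊) =
½Σ_{x′,x″∈Λ₅} a(x′)C(x′,x″)a(x″)` with the boundary weight `a(x′) = Σ_{x∉Λ₅}φ(x)(−D x x′)` (`U = −D`, `D` symmetric).
[cite: Balaban1982Higgs2, (2.38) p.565] -/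
noncomputable def dbl238 (Λ : Finset X) (D CΛ : Matrix X X ℝ) (φ : X → ℝ) : ℝ :=
  1 / 2 * ∑ x' ∈ Λ, ∑ x'' ∈ Λ, bdryWeight Λ D φ x' * CΛ x' x'' * bdryWeight Λ D φ x''

omit [Fintype Y] [DecidableEq Y] in
/-- The double boundary sum is linear in the kernel. [cite: Balaban1982Higgs2, (2.38) p.565] -/
theorem dbl238_sub (Λ : Finset X) (D K₁ K₂ : Matrix X X ℝ) (φ : X → ℝ) :
    dbl238 Λ D K₁ φ - dbl238 Λ D K₂ φ = dbl238 Λ D (K₁ - K₂) φ := by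
  unfold dbl238
  rw [← mul_sub, ← Finset.sum_sub_distrib]
  congr 1
  refine Finset.sum_congr rfl fun x' _ => ?_
  rw [← Finset.sum_sub_distrib]
  refine Finset.sum_congr rfl fun x'' _ => ?_
  rw [Matrix.sub_apply]
  ring

omit [Fintype Y] [DecidableEq Y] in
/-- **(2.38), the exact part**: `½ΣΣ φU C^{(0)}_{Λ₅}(B^{(1)}) Uφ = ½ΣΣ φU C^{(0)}_{Λ₅}(Λ₆ᶜ, B^{(1)}) Uφ + ½ΣΣ φU δC Uφ`,
`δC := C^{(0)}_{Λ₅}(B^{(1)}) − C^{(0)}_{Λ₅}(Λ₆ᶜ, B^{(1)})`, the last summand being the printed `O(ε^κ)|∂Λ₅|`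
(`eq238_error_bound`). [cite: Balaban1982Higgs2, (2.38) p.565] -/
theorem eq238_exact (Λ : Finset X) (D CΛ C6 : Matrix X X ℝ) (φ : X → ℝ) :
    dbl238 Λ D CΛ φ = dbl238 Λ D C6 φ + dbl238 Λ D (CΛ - C6) φ := by
  rw [← dbl238_sub]
  ring

omit [Fintype Y] [DecidableEq Y] in
/-- `|a(x′)| ≤ Gφ·nD` on `Λ₅` if `|φ| ≤ Gφ` at the outer endpoints of `st(Λ₅)` and `Σ_{x∉Λ₅}|D x x′| ≤ nD`.
[cite: Balaban1982Higgs2, (2.38) p.565] -/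
theorem abs_bdryWeight_le {Λ : Finset X} {D : Matrix X X ℝ} {φ : X → ℝ} {Gφ nD : ℝ} (hGφ : 0 ≤ Gφ)
    (hA : ∀ x ∉ Λ, ∀ x' ∈ Λ, D x x' ≠ 0 → |φ x| ≤ Gφ) (hDn : ∀ x', ∑ x ∈ Λᶜ, |D x x'| ≤ nD) (x' : X)
    (hx' : x' ∈ Λ) : |bdryWeight Λ D φ x'| ≤ Gφ * nD := by
  unfold bdryWeight
  calc |∑ x ∈ Λᶜ, φ x * -D x x'| ≤ ∑ x ∈ Λᶜ, |φ x * -D x x'| := Finset.abs_sum_le_sum_abs _ _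
    _ ≤ ∑ x ∈ Λᶜ, Gφ * |D x x'| := Finset.sum_le_sum fun x hx => by
        rw [abs_mul, abs_neg]
        by_cases hD : D x x' = 0
        · rw [hD, abs_zero, mul_zero, mul_zero]
        · exact mul_le_mul_of_nonneg_right (hA x (Finset.mem_compl.1 hx) x' hx' hD) (abs_nonneg _)
    _ = Gφ * ∑ x ∈ Λᶜ, |D x x'| := by rw [Finset.mul_sum]
    _ ≤ Gφ * nD := mul_le_mul_of_nonneg_left (hDn x') hGφ

omit [Fintype Y] [DecidableEq Y] in
/-- A nonzero boundary weight sits at an inner endpoint of `st(Λ₅)`. [cite: Balaban1982Higgs2, (2.38) p.565] -/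
theorem bdryWeight_ne_zero {Λ : Finset X} {D : Matrix X X ℝ} {φ : X → ℝ} {x' : X} (h : bdryWeight Λ D φ x' ≠ 0) :
    ∃ x ∉ Λ, D x x' ≠ 0 := by
  obtain ⟨x, hx, hne⟩ := Finset.exists_ne_zero_of_sum_ne_zero h
  exact ⟨x, Finset.mem_compl.1 hx, fun h0 => hne (by rw [h0, neg_zero, mul_zero])⟩

omit [Fintype Y] [DecidableEq Y] in
/-- **(2.38), the error**: *"+ O(ε^κ)|∂Λ₅|"* — with the row-damped shape for `δC` on the rows at distance `≥ R` from
`Λ₆` (Prop. I.2.1), the separation `hfar` of (2.8) (inner endpoints of `st(Λ₅)` are that far), the threshold `Gφ` for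
`|φ|` at the outer endpoints, `nD`, `Ssum`: `|½ΣΣ a δC a| ≤ ½·(Gφ·bdrySize)·c₀e^{−δ₀R}·(Gφ·nD)·Ssum`.
[cite: Balaban1982Higgs2, (2.38) p.565] -/
theorem eq238_error_bound {Λ : Finset X} {D CΛ C6 : Matrix X X ℝ} {φ : X → ℝ} {d : X → X → ℝ} {v : X → ℝ}
    {c₀ δ R Gφ nD Ssum : ℝ} (hc₀ : 0 ≤ c₀) (hδ : 0 ≤ δ) (hGφ : 0 ≤ Gφ) (hnD : 0 ≤ nD) (hS0 : 0 ≤ Ssum)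
    (hδ6 : ∀ x' ∈ Λ, R ≤ v x' → ∀ x'' ∈ Λ, |CΛ x' x'' - C6 x' x''| ≤ c₀ * Real.exp (-(δ * (d x' x'' + v x'))))
    (hd : ∀ x' x'', 0 ≤ d x' x'') (hfar : ∀ x ∉ Λ, ∀ x' ∈ Λ, D x x' ≠ 0 → R ≤ v x')
    (hA : ∀ x ∉ Λ, ∀ x' ∈ Λ, D x x' ≠ 0 → |φ x| ≤ Gφ) (hDn : ∀ x', ∑ x ∈ Λᶜ, |D x x'| ≤ nD)
    (hS : ∀ x', ∑ x'', Real.exp (-(δ / 2 * d x' x'')) ≤ Ssum) :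
    |dbl238 Λ D (CΛ - C6) φ| ≤ 1 / 2 * ((Gφ * bdrySize Λ D) * (c₀ * Real.exp (-(δ * R)) * (Gφ * nD) * Ssum)) := by
  unfold dbl238
  rw [abs_mul, abs_of_nonneg (by norm_num : (0 : ℝ) ≤ 1 / 2)]
  refine mul_le_mul_of_nonneg_left ?_ (by norm_num)
  have hrow : ∑ x' ∈ Λ, ∑ x'' ∈ Λ, bdryWeight Λ D φ x' * (CΛ - C6) x' x'' * bdryWeight Λ D φ x''
      = ∑ x' ∈ Λ.filter (fun x' => R ≤ v x'), ∑ x'' ∈ Λ,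
          bdryWeight Λ D φ x' * (CΛ - C6) x' x'' * bdryWeight Λ D φ x'' := by
    symm
    apply Finset.sum_subset (Finset.filter_subset _ Λ)
    intro x' hx' hx'f
    have h0 : bdryWeight Λ D φ x' = 0 := by
      by_contra h0
      obtain ⟨x, hx, hD⟩ := bdryWeight_ne_zero h0
      exact hx'f (Finset.mem_filter.2 ⟨hx', hfar x hx x' hx' hD⟩)
    exact Finset.sum_eq_zero fun x'' _ => by rw [h0, zero_mul, zero_mul]
  rw [hrow]
  have hF : ∑ x' ∈ Λ.filter (fun x' => R ≤ v x'), |bdryWeight Λ D φ x'| ≤ Gφ * bdrySize Λ D :=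
    (Finset.sum_le_sum_of_subset_of_nonneg (Finset.filter_subset _ Λ) fun _ _ _ => abs_nonneg _).trans
      (sum_abs_bdryWeight_le hA)
  refine bilin_rowdamped_bound (u := v) (Dk := fun x' x'' => (CΛ - C6) x' x'') hc₀ hδ (mul_nonneg hGφ hnD) hF ?_ ?_
    (fun x' _ x'' _ => hd x' x'') (fun x'' hx'' => abs_bdryWeight_le hGφ hA hDn x'' hx'') hS0 ?_
  · intro x' hx' x'' hx''
    rw [Finset.mem_filter] at hx'
    rw [Matrix.sub_apply]
    exact hδ6 x' hx'.1 hx'.2 x'' hx''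
  · intro x' hx' _
    exact (Finset.mem_filter.1 hx').2
  · intro x' _
    exact (Finset.sum_le_sum_of_subset_of_nonneg (Finset.subset_univ Λ) fun _ _ _ => (Real.exp_pos _).le).trans
      (hS x')

omit [Fintype Y] [DecidableEq Y] in
/-- **(2.38), "for arbitrary κ"**: with `R ≥ r(ℓ)` ((2.8)) and `e^{−δ₀r(ℓ)}·Gφ² ≤ C_κℓ^κ` (the constant of
`decay_thresholds_pow₂` for the printed threshold `Gφ = p(ℓ)(λℓ^{4−d})^{−1/4}`), the error of (2.38) is
`≤ ½c₀·nD·Ssum·C_κℓ^κ·bdrySize` — *"O(ε^κ)|∂Λ₅|"*. [cite: Balaban1982Higgs2, (2.38) p.565] -/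
theorem eq238_error_pow {Λ : Finset X} {D CΛ C6 : Matrix X X ℝ} {φ : X → ℝ} {d : X → X → ℝ} {v : X → ℝ}
    {c₀ δ R Gφ nD Ssum Rr r ℓ κ Cκ : ℝ} (hc₀ : 0 ≤ c₀) (hδ : 0 ≤ δ) (hGφ : 0 ≤ Gφ) (hnD : 0 ≤ nD) (hS0 : 0 ≤ Ssum)
    (hRr : B2.rFn Rr r ℓ ≤ R) (hCκ : Real.exp (-(δ * B2.rFn Rr r ℓ)) * (Gφ * Gφ) ≤ Cκ * ℓ ^ κ)
    (hδ6 : ∀ x' ∈ Λ, R ≤ v x' → ∀ x'' ∈ Λ, |CΛ x' x'' - C6 x' x''| ≤ c₀ * Real.exp (-(δ * (d x' x'' + v x'))))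
    (hd : ∀ x' x'', 0 ≤ d x' x'') (hfar : ∀ x ∉ Λ, ∀ x' ∈ Λ, D x x' ≠ 0 → R ≤ v x')
    (hA : ∀ x ∉ Λ, ∀ x' ∈ Λ, D x x' ≠ 0 → |φ x| ≤ Gφ) (hDn : ∀ x', ∑ x ∈ Λᶜ, |D x x'| ≤ nD)
    (hS : ∀ x', ∑ x'', Real.exp (-(δ / 2 * d x' x'')) ≤ Ssum) :
    |dbl238 Λ D (CΛ - C6) φ| ≤ 1 / 2 * c₀ * nD * Ssum * (Cκ * ℓ ^ κ) * bdrySize Λ D := by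
  have h1 := eq238_error_bound hc₀ hδ hGφ hnD hS0 hδ6 hd hfar hA hDn hS
  have hexp : Real.exp (-(δ * R)) ≤ Real.exp (-(δ * B2.rFn Rr r ℓ)) := by
    rw [Real.exp_le_exp]
    have := mul_le_mul_of_nonneg_left hRr hδ
    linarith
  have h2 : Real.exp (-(δ * R)) * (Gφ * Gφ) ≤ Cκ * ℓ ^ κ :=
    (mul_le_mul_of_nonneg_right hexp (mul_nonneg hGφ hGφ)).trans hCκ
  have hN : 0 ≤ bdrySize Λ D := Finset.sum_nonneg fun _ _ => Finset.sum_nonneg fun _ _ => abs_nonneg _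
  calc |dbl238 Λ D (CΛ - C6) φ|
      ≤ 1 / 2 * ((Gφ * bdrySize Λ D) * (c₀ * Real.exp (-(δ * R)) * (Gφ * nD) * Ssum)) := h1
    _ = 1 / 2 * c₀ * nD * Ssum * (Real.exp (-(δ * R)) * (Gφ * Gφ)) * bdrySize Λ D := by ring
    _ ≤ 1 / 2 * c₀ * nD * Ssum * (Cκ * ℓ ^ κ) * bdrySize Λ D := by
        apply mul_le_mul_of_nonneg_right _ hN
        exact mul_le_mul_of_nonneg_left h2 (by positivity)

/-! ## §3 **(2.39)**: the mixed boundary term -/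

omit [DecidableEq Y] in
/-- The boundary sum (2.26)/(2.39) is linear in the kernel. [cite: Balaban1982Higgs2, (2.39) p.565] -/
theorem bdry226_kernel_sub (c : ℝ) (Λ : Finset X) (D K₁ K₂ : Matrix X X ℝ) (Qs : Matrix X Y ℝ) (φ : X → ℝ)
    (ψ : Y → ℝ) :
    bdry226 c Λ D K₁ Qs φ ψ - bdry226 c Λ D K₂ Qs φ ψ = bdry226 c Λ D (K₁ - K₂) Qs φ ψ := by
  unfold bdry226
  rw [← mul_sub, ← Finset.sum_sub_distrib]
  congr 1
  refine Finset.sum_congr rfl fun x _ => ?_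
  rw [← Finset.sum_sub_distrib]
  refine Finset.sum_congr rfl fun x' _ => ?_
  rw [Matrix.sub_mulVec, Pi.sub_apply]
  ring

omit [DecidableEq Y] in
/-- **(2.39), the exact part**: `aL⁻²Σ_{st(Λ₅)}φ(b₊)U(C^{(0)}_{Λ₅}(B^{(1)})Q*ψ)(b₋) = aL⁻²Σ_{st(Λ₅)}φ(b₊)U(C^{(0)}_{Λ₅}(Λ₆ᶜ,
B^{(1)})Q*ψ)(b₋) + [the same with δC]`, the last summand being the printed `O(ε^κ)|∂Λ₅|` (`eq239_error_bound`).
[cite: Balaban1982Higgs2, (2.39) p.565] -/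
theorem eq239_exact (c : ℝ) (Λ : Finset X) (D CΛ C6 : Matrix X X ℝ) (Qs : Matrix X Y ℝ) (φ : X → ℝ) (ψ : Y → ℝ) :
    bdry226 c Λ D CΛ Qs φ ψ = bdry226 c Λ D C6 Qs φ ψ + bdry226 c Λ D (CΛ - C6) Qs φ ψ := by
  rw [← bdry226_kernel_sub]
  ring

omit [Fintype X] [DecidableEq X] [DecidableEq Y] in
/-- `|(Q*ψ)(x″)| ≤ qs₁·Gψ` at `x″ ∈ Λ₅` if `|ψ| ≤ Gψ` on `Λ′₅` (block structure: `Q*(x″, y) ≠ 0`, `x″ ∈ Λ₅ ⇒ y ∈ Λ′₅`).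
[cite: Balaban1982Higgs2, (2.17) p.560] -/
theorem abs_Qs_mulVec_le_of_mem {w : ℝ} {Λ : Finset X} {Λ' : Finset Y} {Q : Matrix Y X ℝ} {Qs : Matrix X Y ℝ}
    {ψ : Y → ℝ} {Gψ qs₁ : ℝ} (hQs : Qs = w • Qᵀ) (hQ : ∀ y x, Q y x ≠ 0 → (x ∈ Λ ↔ y ∈ Λ')) (hGψ : 0 ≤ Gψ)
    (hψ : ∀ y ∈ Λ', |ψ y| ≤ Gψ) (hQs1 : ∀ x'', ∑ y, |Qs x'' y| ≤ qs₁) {x'' : X} (hx'' : x'' ∈ Λ) :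
    |(Qs *ᵥ ψ) x''| ≤ qs₁ * Gψ := by
  calc |(Qs *ᵥ ψ) x''| = |∑ y, Qs x'' y * ψ y| := rfl
    _ ≤ ∑ y, |Qs x'' y * ψ y| := Finset.abs_sum_le_sum_abs _ _
    _ ≤ ∑ y, |Qs x'' y| * Gψ := Finset.sum_le_sum fun y _ => by
        rw [abs_mul]
        by_cases hq : Qs x'' y = 0
        · rw [hq, abs_zero, zero_mul, zero_mul]
        · have hQy : Q y x'' ≠ 0 := by
            intro h0
            apply hq
            rw [hQs, Matrix.smul_apply, Matrix.transpose_apply, h0, smul_zero]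
          exact mul_le_mul_of_nonneg_left (hψ y ((hQ y x'' hQy).1 hx'')) (abs_nonneg _)
    _ = (∑ y, |Qs x'' y|) * Gψ := by rw [Finset.sum_mul]
    _ ≤ qs₁ * Gψ := mul_le_mul_of_nonneg_right (hQs1 x'') hGψ

omit [DecidableEq Y] in
/-- **(2.39), the error**: *"+ O(ε^κ)|∂Λ₅|"* — with the row-damped shape for `δC` (Prop. I.2.1), the Dirichlet supports
of both kernels, the separation `hfar` of (2.8), the thresholds `Gφ` (outer endpoints of `st(Λ₅)`) and `Gψ` (on `Λ′₅`), the
row-sum bound `qs₁` of `Q*`: `|aL⁻²Σ_{st(Λ₅)}φ(b₊)U(δC Q*ψ)(b₋)| ≤ |c|·(Gφ·bdrySize)·c₀e^{−δ₀R}·(qs₁Gψ)·Ssum`.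
[cite: Balaban1982Higgs2, (2.39) p.565] -/
theorem eq239_error_bound {c w : ℝ} {Λ : Finset X} {Λ' : Finset Y} {D CΛ C6 : Matrix X X ℝ} {Q : Matrix Y X ℝ}
    {Qs : Matrix X Y ℝ} {φ : X → ℝ} {ψ : Y → ℝ} {d : X → X → ℝ} {v : X → ℝ} {c₀ δ R Gφ Gψ qs₁ Ssum : ℝ}
    (hc₀ : 0 ≤ c₀) (hδ : 0 ≤ δ) (hGψ : 0 ≤ Gψ) (hqs : 0 ≤ qs₁) (hS0 : 0 ≤ Ssum)
    (hQs : Qs = w • Qᵀ) (hQ : ∀ y x, Q y x ≠ 0 → (x ∈ Λ ↔ y ∈ Λ'))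
    (hCs : ∀ x x', CΛ x x' ≠ 0 → x ∈ Λ ∧ x' ∈ Λ) (hCs6 : ∀ x x', C6 x x' ≠ 0 → x ∈ Λ ∧ x' ∈ Λ)
    (hδ6 : ∀ x' ∈ Λ, R ≤ v x' → ∀ x'' ∈ Λ, |CΛ x' x'' - C6 x' x''| ≤ c₀ * Real.exp (-(δ * (d x' x'' + v x'))))
    (hd : ∀ x' x'', 0 ≤ d x' x'') (hfar : ∀ x ∉ Λ, ∀ x' ∈ Λ, D x x' ≠ 0 → R ≤ v x')
    (hA : ∀ x ∉ Λ, ∀ x' ∈ Λ, D x x' ≠ 0 → |φ x| ≤ Gφ) (hψ : ∀ y ∈ Λ', |ψ y| ≤ Gψ)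
    (hQs1 : ∀ x'', ∑ y, |Qs x'' y| ≤ qs₁) (hS : ∀ x', ∑ x'', Real.exp (-(δ / 2 * d x' x'')) ≤ Ssum) :
    |bdry226 c Λ D (CΛ - C6) Qs φ ψ|
      ≤ |c| * ((Gφ * bdrySize Λ D) * (c₀ * Real.exp (-(δ * R)) * (qs₁ * Gψ) * Ssum)) := by
  rw [bdry226_eq_sum_weight, abs_mul]
  refine mul_le_mul_of_nonneg_left ?_ (abs_nonneg c)
  have hK0 : ∀ x' x'', x'' ∉ Λ → (CΛ - C6) x' x'' = 0 := by
    intro x' x'' hx''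
    rw [Matrix.sub_apply]
    have h1 : CΛ x' x'' = 0 := by
      by_contra h
      exact hx'' (hCs x' x'' h).2
    have h2 : C6 x' x'' = 0 := by
      by_contra h
      exact hx'' (hCs6 x' x'' h).2
    rw [h1, h2, sub_zero]
  have hre : ∑ x' ∈ Λ, ∑ x'' : X, bdryWeight Λ D φ x' * (CΛ - C6) x' x'' * (Qs *ᵥ ψ) x''
      = ∑ x' ∈ Λ.filter (fun x' => R ≤ v x'), ∑ x'' ∈ Λ,
          bdryWeight Λ D φ x' * (CΛ - C6) x' x'' * (Qs *ᵥ ψ) x'' := by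
    symm
    refine (Finset.sum_subset (Finset.filter_subset _ Λ) fun x' hx' hx'f => ?_).trans
      (Finset.sum_congr rfl fun x' _ => Finset.sum_subset (Finset.subset_univ Λ) fun x'' _ hx'' => ?_)
    · have h0 : bdryWeight Λ D φ x' = 0 := by
        by_contra h0
        obtain ⟨x, hx, hD⟩ := bdryWeight_ne_zero h0
        exact hx'f (Finset.mem_filter.2 ⟨hx', hfar x hx x' hx' hD⟩)
      exact Finset.sum_eq_zero fun x'' _ => by rw [h0, zero_mul, zero_mul]
    · rw [hK0 x' x'' hx'', mul_zero, zero_mul]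
  rw [hre]
  have hF : ∑ x' ∈ Λ.filter (fun x' => R ≤ v x'), |bdryWeight Λ D φ x'| ≤ Gφ * bdrySize Λ D :=
    (Finset.sum_le_sum_of_subset_of_nonneg (Finset.filter_subset _ Λ) fun _ _ _ => abs_nonneg _).trans
      (sum_abs_bdryWeight_le hA)
  refine bilin_rowdamped_bound (u := v) (Dk := fun x' x'' => (CΛ - C6) x' x'') hc₀ hδ (mul_nonneg hqs hGψ) hF ?_ ?_
    (fun x' _ x'' _ => hd x' x'') (fun x'' hx'' => abs_Qs_mulVec_le_of_mem hQs hQ hGψ hψ hQs1 hx'') hS0 ?_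
  · intro x' hx' x'' hx''
    rw [Finset.mem_filter] at hx'
    rw [Matrix.sub_apply]
    exact hδ6 x' hx'.1 hx'.2 x'' hx''
  · intro x' hx' _
    exact (Finset.mem_filter.1 hx').2
  · intro x' _
    exact (Finset.sum_le_sum_of_subset_of_nonneg (Finset.subset_univ Λ) fun _ _ _ => (Real.exp_pos _).le).trans
      (hS x')

omit [DecidableEq Y] in
/-- **(2.39), "for arbitrary κ"**: with `R ≥ r(ℓ)` and `e^{−δ₀r(ℓ)}·GφGψ ≤ C_κℓ^κ` (`decay_thresholds_pow₂` for the printed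
thresholds), the error of (2.39) is `≤ |c|c₀qs₁·Ssum·C_κℓ^κ·bdrySize` — *"O(ε^κ)|∂Λ₅|"*.
[cite: Balaban1982Higgs2, (2.39) p.565] -/
theorem eq239_error_pow {c w : ℝ} {Λ : Finset X} {Λ' : Finset Y} {D CΛ C6 : Matrix X X ℝ} {Q : Matrix Y X ℝ}
    {Qs : Matrix X Y ℝ} {φ : X → ℝ} {ψ : Y → ℝ} {d : X → X → ℝ} {v : X → ℝ}
    {c₀ δ R Gφ Gψ qs₁ Ssum Rr r ℓ κ Cκ : ℝ}
    (hc₀ : 0 ≤ c₀) (hδ : 0 ≤ δ) (hGφ : 0 ≤ Gφ) (hGψ : 0 ≤ Gψ) (hqs : 0 ≤ qs₁) (hS0 : 0 ≤ Ssum)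
    (hRr : B2.rFn Rr r ℓ ≤ R) (hCκ : Real.exp (-(δ * B2.rFn Rr r ℓ)) * (Gφ * Gψ) ≤ Cκ * ℓ ^ κ)
    (hQs : Qs = w • Qᵀ) (hQ : ∀ y x, Q y x ≠ 0 → (x ∈ Λ ↔ y ∈ Λ'))
    (hCs : ∀ x x', CΛ x x' ≠ 0 → x ∈ Λ ∧ x' ∈ Λ) (hCs6 : ∀ x x', C6 x x' ≠ 0 → x ∈ Λ ∧ x' ∈ Λ)
    (hδ6 : ∀ x' ∈ Λ, R ≤ v x' → ∀ x'' ∈ Λ, |CΛ x' x'' - C6 x' x''| ≤ c₀ * Real.exp (-(δ * (d x' x'' + v x'))))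
    (hd : ∀ x' x'', 0 ≤ d x' x'') (hfar : ∀ x ∉ Λ, ∀ x' ∈ Λ, D x x' ≠ 0 → R ≤ v x')
    (hA : ∀ x ∉ Λ, ∀ x' ∈ Λ, D x x' ≠ 0 → |φ x| ≤ Gφ) (hψ : ∀ y ∈ Λ', |ψ y| ≤ Gψ)
    (hQs1 : ∀ x'', ∑ y, |Qs x'' y| ≤ qs₁) (hS : ∀ x', ∑ x'', Real.exp (-(δ / 2 * d x' x'')) ≤ Ssum) :
    |bdry226 c Λ D (CΛ - C6) Qs φ ψ| ≤ |c| * c₀ * qs₁ * Ssum * (Cκ * ℓ ^ κ) * bdrySize Λ D := by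
  have h1 := eq239_error_bound hc₀ hδ hGψ hqs hS0 hQs hQ hCs hCs6 hδ6 hd hfar hA hψ hQs1 hS (c := c)
  have hexp : Real.exp (-(δ * R)) ≤ Real.exp (-(δ * B2.rFn Rr r ℓ)) := by
    rw [Real.exp_le_exp]
    have := mul_le_mul_of_nonneg_left hRr hδ
    linarith
  have h2 : Real.exp (-(δ * R)) * (Gφ * Gψ) ≤ Cκ * ℓ ^ κ :=
    (mul_le_mul_of_nonneg_right hexp (mul_nonneg hGφ hGψ)).trans hCκ
  have hN : 0 ≤ bdrySize Λ D := Finset.sum_nonneg fun _ _ => Finset.sum_nonneg fun _ _ => abs_nonneg _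
  calc |bdry226 c Λ D (CΛ - C6) Qs φ ψ|
      ≤ |c| * ((Gφ * bdrySize Λ D) * (c₀ * Real.exp (-(δ * R)) * (qs₁ * Gψ) * Ssum)) := h1
    _ = |c| * c₀ * qs₁ * Ssum * (Real.exp (-(δ * R)) * (Gφ * Gψ)) * bdrySize Λ D := by ring
    _ ≤ |c| * c₀ * qs₁ * Ssum * (Cκ * ℓ ^ κ) * bdrySize Λ D := by
        apply mul_le_mul_of_nonneg_right _ hN
        exact mul_le_mul_of_nonneg_left h2 (by positivity)

end Scalar

end Literature.MathematicalPhysics.QuantumFieldTheory.Balaban1983to89.B2Eq238ScalarBoundary
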